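import Summits.CriticalPhenomena.PercolationContinuityZ3.Theorems.PercLowPointHalfSpaceQuantitativeBGNFloorDefs
import HarnessLib

/-!
# `QuantitativeBGN` (stmt-CriticalPhenomena-0913), line `microscopic-floor-doubling-gain` — locality of the arm event

Basic API of the depth-indexed arm event `armFrom r h` of
`Theorems/PercLowPointHalfSpaceQuantitativeBGNFloorDefs.lean` (crux
`Summit.CriticalPhenomena.PercolationContinuityZ3.Theses.PercLowPointHalfSpace.QuantitativeBGN`, line
`microscopic-floor-doubling-gain`), used by every stub of the line:

* `isUpperSet_armFrom` — the event is increasing;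
* `armFrom_eq_local` — FIRST EXIT: the arm may be required to stay inside the sup-ball of radius `r`
  about its start (stop the path at its first vertex at sup-distance `≥ r`);
* `determinedBy_armFrom` — hence the event is determined by the finite set of pairs of points of
  `Λ_{r+h}` (`(box 3 (r+h)).sym2`), and `measurableSet_armFrom`;
* `determinedBy_armFrom_halfSpace` — it is also determined by the pairs of points of `H = {x₀ ≥ 0}`.

All proofs are path surgery on `PathIn` (`SitePaths.lean`, `DCT16.mem_openConnIn_iff_pathIn`).
-/

noncomputable section

open MeasureTheory Literature.Probability.Percolation Literature.Probability.LatticeModels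
open scoped Classical

namespace Summit.CriticalPhenomena.PercolationContinuityZ3.Theorems.FloorDoubling

/-- The starting point `h·e₀` of the depth-`h` arm. [folklore] -/
theorem start_apply (h : ℕ) (i : Fin 3) :
    (Pi.single 0 (h : ℤ) : Site 3) i = if i = 0 then (h : ℤ) else 0 := by
  by_cases hi : i = 0
  · subst hi; simp
  · simp [hi]

/-- **`armFrom r h` is increasing.** [folklore] -/
theorem isUpperSet_armFrom (r h : ℕ) : IsUpperSet (armFrom r h) := by
  intro ω ω' hle hω
  obtain ⟨y, hy, hconn⟩ := hω
  exact ⟨y, hy, isUpperSet_openConnIn _ _ _ (Set.inter_subset_inter_left _ hle) hconn⟩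

/-- The sup-ball of radius `r` about a point `s`, as a set of sites. [folklore] -/
theorem mem_ball_iff {r : ℕ} {s w : Site 3} :
    w - s ∈ (box 3 r : Set (Site 3)) ↔ ∀ i, |w i - s i| ≤ r := by
  rw [Finset.mem_coe, mem_box]
  refine forall_congr' fun i => ?_
  rw [Pi.sub_apply, abs_le]

/-- **First exit of an open half-space path from the sup-ball about its start.** An open path inside
`H` from `s` to a point at sup-distance `≥ r` from `s` contains an initial segment inside
`H ∩ (s + Λ_r)` ending at a point at sup-distance `≥ r` from `s` (its first vertex outside
`s + Λ_{r-1}`). [folklore] -/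
theorem exists_pathIn_ball {ω : BondConfig (Site 3)} {s y : Site 3} {r : ℕ}
    (hpath : PathIn (openGraph (ω ∩ (zdGraph 3).edgeSet)) {x : Site 3 | 0 ≤ x 0} s y)
    (hy : ∃ i : Fin 3, (r : ℤ) ≤ |y i - s i|) :
    ∃ b : Site 3, (∃ i : Fin 3, (r : ℤ) ≤ |b i - s i|) ∧
      PathIn (openGraph (ω ∩ (zdGraph 3).edgeSet))
        ({x : Site 3 | 0 ≤ x 0} ∩ {w | w - s ∈ (box 3 r : Set (Site 3))}) s b := by
  obtain ⟨i, hi⟩ := hy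
  have hsH : s ∈ {x : Site 3 | 0 ≤ x 0} := hpath.left_mem
  rcases Nat.eq_zero_or_pos r with hr | hr
  · -- `r = 0`: the start itself is a witness
    subst hr
    refine ⟨s, ⟨0, by simp⟩, PathIn.refl ⟨hsH, ?_⟩⟩
    simp [mem_box]
  · -- `r ≥ 1`: first exit from `s + Λ_{r-1}`
    have hsR : s ∈ {w : Site 3 | w - s ∈ (box 3 (r - 1) : Set (Site 3))} := by simp [mem_box]
    have hyR : y ∉ {w : Site 3 | w - s ∈ (box 3 (r - 1) : Set (Site 3))} := by
      intro hyR
      have h1 := (mem_ball_iff.1 hyR) i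
      push_cast [Nat.cast_sub hr] at h1
      omega
    obtain ⟨a, b, ha, hb, hbH, hab, hpa⟩ := hpath.exit hsR hyR
    have hadj : (zdGraph 3).Adj a b := DCT16.adj_of_openGraph_adj Set.inter_subset_right hab
    have haball : ∀ j, |a j - s j| ≤ ((r - 1 : ℕ) : ℤ) := mem_ball_iff.1 ha
    have hbball : b - s ∈ (box 3 r : Set (Site 3)) := by
      rw [mem_ball_iff]
      intro j
      have h1 := DCT16.abs_sub_le_one_of_adj hadj j
      have h2 := haball j
      push_cast [Nat.cast_sub hr] at h2
      rw [abs_le] at h1 h2 ⊢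
      constructor <;> omega
    have hbfar : ∃ j : Fin 3, (r : ℤ) ≤ |b j - s j| := by
      by_contra hcon
      push Not at hcon
      refine hb (mem_ball_iff.2 fun j => ?_)
      have h1 := hcon j
      push_cast [Nat.cast_sub hr]
      rw [abs_lt] at h1
      rw [abs_le]
      constructor <;> omega
    refine ⟨b, hbfar, ?_⟩
    have hpa' : PathIn (openGraph (ω ∩ (zdGraph 3).edgeSet))
        ({x : Site 3 | 0 ≤ x 0} ∩ {w | w - s ∈ (box 3 r : Set (Site 3))}) s a := by
      refine hpa.mono fun w hw => ⟨hw.2, ?_⟩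
      have h1 := mem_ball_iff.1 hw.1
      refine mem_ball_iff.2 fun j => ?_
      have h2 := h1 j
      push_cast [Nat.cast_sub hr] at h2
      rw [abs_le] at h2 ⊢
      constructor <;> omega
    exact hpa'.tail hab ⟨hbH, hbball⟩

/-- **First exit (locality of the arm event).** `ω ∈ armFrom r h` iff the start `h·e₀` is joined,
inside `H ∩ (h·e₀ + Λ_r)`, to a point at sup-distance `≥ r` from the start. [folklore] -/
theorem armFrom_eq_local (r h : ℕ) :
    armFrom r h = {ω | ∃ y : Site 3, (∃ i : Fin 3, (r : ℤ) ≤ |y i - (Pi.single 0 (h : ℤ) : Site 3) i|) ∧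
      ω ∩ (zdGraph 3).edgeSet ∈ openConnIn ({x : Site 3 | 0 ≤ x 0} ∩
        {w | w - (Pi.single 0 (h : ℤ) : Site 3) ∈ (box 3 r : Set (Site 3))}) (Pi.single 0 (h : ℤ)) y} := by
  ext ω
  constructor
  · rintro ⟨y, hy, hconn⟩
    obtain ⟨b, hb, hpath⟩ := exists_pathIn_ball (DCT16.mem_openConnIn_iff_pathIn.1 hconn) hy
    exact ⟨b, hb, DCT16.mem_openConnIn_iff_pathIn.2 hpath⟩
  · rintro ⟨y, hy, hconn⟩
    exact ⟨y, hy, openConnIn_mono Set.inter_subset_left _ _ hconn⟩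

/-- The sup-ball of radius `r` about `h·e₀` lies in `Λ_{r+h}`. [folklore] -/
theorem ball_subset_box (r h : ℕ) :
    {w : Site 3 | w - (Pi.single 0 (h : ℤ) : Site 3) ∈ (box 3 r : Set (Site 3))} ⊆ (box 3 (r + h) : Set (Site 3)) := by
  intro w hw
  rw [Finset.mem_coe, mem_box]
  intro i
  have := (mem_ball_iff.1 hw) i
  rw [start_apply] at this
  rw [abs_le] at this
  push_cast
  split_ifs at this <;> constructor <;> omega

/-- **The arm event is determined by the pairs of points of `Λ_{r+h}`** (a finite set), in the
configuration read on the lattice part. [folklore] -/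
theorem determinedBy_armFrom (r h : ℕ) :
    DeterminedBy (armFrom r h) (↑((box 3 (r + h)).sym2) : Set (Sym2 (Site 3))) := by
  rw [determinedBy_iff]
  intro ω ω' hK
  set S : Set (Site 3) := {x : Site 3 | 0 ≤ x 0} ∩
    {w | w - (Pi.single 0 (h : ℤ) : Site 3) ∈ (box 3 r : Set (Site 3))} with hS
  have hSK : S.sym2 ⊆ (↑((box 3 (r + h)).sym2) : Set (Sym2 (Site 3))) := by
    rw [Finset.coe_sym2]
    intro z hz
    exact Set.mem_sym2_iff_subset.2
      ((Set.mem_sym2_iff_subset.1 hz).trans fun w hw => ball_subset_box r h hw.2)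
  have hagree : (ω ∩ (zdGraph 3).edgeSet) ∩ S.sym2 = (ω' ∩ (zdGraph 3).edgeSet) ∩ S.sym2 := by
    have h1 : ω ∩ S.sym2 = ω' ∩ S.sym2 := by
      rw [← Set.inter_eq_self_of_subset_right hSK, ← Set.inter_assoc, ← Set.inter_assoc, hK]
    rw [Set.inter_assoc, Set.inter_comm _ S.sym2, ← Set.inter_assoc, h1, Set.inter_assoc,
      Set.inter_comm S.sym2, ← Set.inter_assoc]
  rw [armFrom_eq_local]
  simp only [Set.mem_setOf_eq]
  refine exists_congr fun y => and_congr_right fun _ => ?_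
  have hdet := DCT16.determinedBy_openConnIn S (Pi.single 0 (h : ℤ)) y (K := S.sym2) subset_rfl
  rw [determinedBy_iff] at hdet
  exact hdet _ _ hagree

/-- `armFrom r h` is measurable. [folklore] -/
theorem measurableSet_armFrom (r h : ℕ) : MeasurableSet (armFrom r h) :=
  (determinedBy_armFrom r h).measurableSet_of_finset

/-- **The arm event is determined by the pairs of points of the half-space** `H = {x₀ ≥ 0}`. [folklore] -/
theorem determinedBy_armFrom_halfSpace (r h : ℕ) :
    DeterminedBy (armFrom r h) ({x : Site 3 | 0 ≤ x 0}.sym2) := by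
  rw [determinedBy_iff]
  intro ω ω' hK
  set H : Set (Site 3) := {x : Site 3 | 0 ≤ x 0} with hH
  have hagree : (ω ∩ (zdGraph 3).edgeSet) ∩ H.sym2 = (ω' ∩ (zdGraph 3).edgeSet) ∩ H.sym2 := by
    rw [Set.inter_assoc, Set.inter_comm _ H.sym2, ← Set.inter_assoc, hK, Set.inter_assoc,
      Set.inter_comm H.sym2, ← Set.inter_assoc]
  simp only [mem_armFrom]
  refine exists_congr fun y => and_congr_right fun _ => ?_
  have hdet := DCT16.determinedBy_openConnIn H (Pi.single 0 (h : ℤ)) y (K := H.sym2) subset_rfl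
  rw [determinedBy_iff] at hdet
  exact hdet _ _ hagree

/-- **Readback at `s = 1`**: `f_j(1) = γ_r(j)` — at full floor density the floor-diluted half-space
measure agrees with critical bond percolation on the arm event (`floorDilutedPercolation_one_apply_eq`).
[folklore] -/
theorem armProbFloor_one (r j : ℕ) : armProbFloor r j 1 = gammaR r j := by
  rw [armProbFloor, gammaR, Measure.real, Measure.real,
    floorDilutedPercolation_one_apply_eq (criticalProbI 3) (determinedBy_armFrom_halfSpace r j)
      (measurableSet_armFrom r j)]

/-- Binder-free form of `armProbFloor_one` (the registered closed sub-goal this file lands under):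
`f_j(1) = γ_r(j)` for all `r, j`. [folklore] -/
theorem armProbFloor_one_all : ∀ r j : ℕ, armProbFloor r j 1 = gammaR r j := armProbFloor_one

end Summit.CriticalPhenomena.PercolationContinuityZ3.Theorems.FloorDoubling

end
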